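import Summits.QuantumFields.BalabanUV.Beta.FP.PuncturedCoordDeriv

/-!
# `BalabanUV.Beta.FP.PuncturedCoordDerivMajorant` — road «FP» for binder row D1, leaf H2-P, generic tool for row H2-P-KER-ASM's RATE, re-cut of
# `FP/PuncturedCoordDeriv` §1–§4: the TOP member of the punctured slice chain needs only SLICE MEASURABILITY and an INTEGRABLE MAJORANT on the zone

HONEST DEPENDENCY (page 1, mandatory): continuum YM on T⁴ ⇐ BetaPertH ∧ nine spine estimates (0/9 proved); BetaPertH ⇐ (D1) ∧ (D4) ∧ CAP+tail;
G-an2-4 gates asym, D1 and NE2/3/4.  HONEST FRAMING (cell contract, verbatim): «discharging `BetaPertH` makes Bałaban's UV stability UNCONDITIONAL —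
a real constructive-QFT result; it is NOT the continuum limit and NOT the Clay problem.»  THIS MODULE DISCHARGES NOTHING of the wall: [folklore] harmonic
analysis on the torus (Katznelson I.4.4 ∕ Grafakos Thm. 3.3.9 (a), coordinatewise integration by parts; Fubini–Tonelli on the box), as in `FP/PuncturedCoordDeriv`
(p233319), with ONE hypothesis re-cut.  WHY THE RE-CUT: `PuncturedCoordDeriv.norm_latticeKernel_le_div_supNorm_pow` asks `IntegrableOn (integrand (F μ j) x) (BZ (d+1))`
for every member of the chain, i.e. joint `(d+1)`-variable measurability of `s ↦ ∂ᵢʲG(s)`; for the remainder symbol `B` of H2-P-KER the tree knows the regularity of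
the weights `W_∞` only SLICE-WISE (`PerfectSymbol166RealLine.hasDerivAt_DW_ofReal`, `PerfectSymbolDeriv.contDiffOn_reW_slice`), so joint measurability of
`∂ᵢ³B` is not available, whereas (i) measurability of each ONE-DIMENSIONAL top slice is free (a derivative of a continuous function, Mathlib `measurable_deriv`) and
(ii) the letters `‖∂ᵢʳB(s)‖ ≤ C‖s‖^{−r}` give an integrable RADIAL MAJORANT (`FP/BrillouinRadial`).  Here the IBP runs slice by slice and only the majorant is
integrated over the box (Tonelli), so (i)+(ii) suffice.  No `def`, no `def … : Prop`, nothing cited as a hypothesis, 0 sorry; 0 wall binders; NOT D1, NOT BetaPertH,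
NOT continuum, NOT Clay.  «not in print as used here; our bookkeeping».

ABSOLUTE RULE (cell charter, verbatim): «No internally-minted statement may enter as a cited fact. Every hypothesis is either kernel-proved in this package or a
verbatim quotation of a PUBLISHED theorem with page reference. The manuscript(s) under audit are NOT citable for their own disputed steps — they are the thing
under adjudication; programme-internal (2001/route/tribunal) claims are never citable.»

WHAT (lattice dimension `d + 1`, coordinate `i`, slices `t ↦ i.insertNth t q`, `q ∈ [−π,π]^d`):
* §0 [folklore] `integral_iteratedDeriv_mul_char_Ioo'` — the iterated 1-D integration by parts of `PuncturedCoordDeriv` §0 with the top member `F r` only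
  INTERVAL-INTEGRABLE (continuity is asked of `F 0, …, F (r−1)` only).
* §1 [folklore] Fubini on the box, singling out the coordinate `i`, for an ARBITRARY integrable `f : [−π,π]^{d+1} → E` (`B4ContourShift.fourierBox_eq_iterated` is the
  case `f = integrand G x`): `setIntegral_BZ_eq_iterated` (`∫_{BZ (d+1)} f = ∫_{q ∈ BZ d} ∫_{t ∈ [−π,π]} f (insertNth i t q)`), `integrableOn_sliceIntegral`
  (the inner integral is integrable in `q`), `ae_integrableOn_slice` (a.e. slice is integrable).
* §2 **`norm_fourierBox_le_of_coordDeriv_majorant`** — punctured slice chain `F 0 … F r` in the coordinate `i` off a null set `N` of transverse momenta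
  (links on the open interval, continuity on the closed one and periodic endpoint VALUES for the members `j < r`), the top member with a.e.-measurable slices and
  majorised on the slices by an integrable `g ≥ ‖F r‖`: `|x_i|^r · ‖fourierBox (F 0) x‖ ≤ ∫_{BZ (d+1)} g`; `norm_latticeKernel_le_of_coordDeriv_majorant` (same for
  the normalised kernel, `(2π)^{−(d+1)}` in front).
* §3 **`norm_latticeKernel_le_div_supNorm_pow_of_majorant`** — such a chain in EVERY coordinate with a common majorant `g`:
  `‖latticeKernel G x‖ ≤ (2π)^{−(d+1)}·(∫_{BZ} g) ∕ ‖x‖_∞^r` for `x ≠ 0`.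
Provenance: G-an2-4 swarm leaf prover 05, gen 35 (prover-b2b-balaban-gan24-formalise-leaf-05-g35-0), cross-lane on road FP (row H2-P-KER-ASM, owner
re-assignment l.21097, INTENT l.21819), 2026-08-20.
-/

noncomputable section

namespace Summit.QuantumFields.BalabanUV.Beta.FP.PuncturedCoordDerivMajorant

open MeasureTheory Set Complex Filter Topology
open scoped Real
open Literature.MathematicalPhysics.QuantumFieldTheory.Balaban1983to89
open B4Strip (ofRealVec)
open B4ContourShift (BZ phase integrand fourierBox latticeKernel fourierBox_eq_iterated ofRealVec_insertNth phase_insertNth norm_cexp_phase)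
open Summit.QuantumFields.BalabanUV.Beta.FP.PuncturedCoordDeriv (integral_deriv_mul_char_Ioo)

variable {d : ℕ}

/-! ## §0 Iterated 1-D integration by parts, top member only interval-integrable -/

/-- [folklore] ITERATED integration by parts against `e^{itn}`, interior derivatives, periodic endpoint values, with CONTINUITY asked of `F 0, …, F (r−1)` and
only INTERVAL-INTEGRABILITY of the top member `F r`: `∫ F r · e^{itn} = (-(in))^r ∫ F 0 · e^{itn}`. -/
theorem integral_iteratedDeriv_mul_char_Ioo' {n : ℤ} (r : ℕ) (F : ℕ → ℝ → ℂ)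
    (hF : ∀ j < r, ∀ t ∈ Set.Ioo (-π) π, HasDerivAt (F j) (F (j + 1) t) t)
    (hFc : ∀ j < r, ContinuousOn (F j) (Set.uIcc (-π) π)) (hFr : IntervalIntegrable (F r) volume (-π) π)
    (hper : ∀ j < r, F j (-π) = F j π) :
    (∫ t in (-π)..π, F r t * cexp (I * (t : ℂ) * n)) = (-(I * n)) ^ r * ∫ t in (-π)..π, F 0 t * cexp (I * (t : ℂ) * n) := by
  induction r with
  | zero => simp
  | succ r ih =>
    have h1 := integral_deriv_mul_char_Ioo (f := F r) (f' := F (r + 1)) (n := n) (hFc r (Nat.lt_succ_self r)) (hF r (Nat.lt_succ_self r))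
      hFr (hper r (Nat.lt_succ_self r))
    rw [h1, ih (fun j hj => hF j (Nat.lt_succ_of_lt hj)) (fun j hj => hFc j (Nat.lt_succ_of_lt hj))
      ((hFc r (Nat.lt_succ_self r)).intervalIntegrable) (fun j hj => hper j (Nat.lt_succ_of_lt hj))]
    ring

/-! ## §1 Fubini on the box for an arbitrary integrable function, singling out one coordinate -/

section Fubini

variable {E : Type*} [NormedAddCommGroup E]

/-- [folklore] the product form of an integrable function on the box: `(q, t) ↦ f (insertNth i t q)` is integrable for the product of the restricted
measures `volume|_{BZ d} ⊗ volume|_{[−π,π]}` (through `MeasurableEquiv.piFinSuccAbove`, the template of `B4ContourShift.fourierBox_eq_iterated`). -/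
theorem integrable_swap_slices (f : (Fin (d + 1) → ℝ) → E) (i : Fin (d + 1)) (hf : IntegrableOn f (BZ (d + 1)) volume) :
    Integrable (fun z : (Fin d → ℝ) × ℝ => f (i.insertNth z.2 z.1))
      ((volume.restrict (BZ d)).prod (volume.restrict (Icc (-π) π))) := by
  set e : ℝ × (Fin d → ℝ) ≃ᵐ (Fin (d + 1) → ℝ) := (MeasurableEquiv.piFinSuccAbove (fun _ => ℝ) i).symm with he_def
  have hem : MeasurePreserving e :=
    (volume_preserving_piFinSuccAbove (fun _ : Fin (d + 1) => ℝ) i).symm _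
  have heπ : (e ⁻¹' Icc (fun _ => -π) fun _ => π) = Icc (-π) π ×ˢ Icc (fun _ : Fin d => -π) (fun _ => π) :=
    ((Fin.insertNthOrderIso (fun _ => ℝ) i).preimage_Icc _ _).trans (Icc_prod_eq _ _)
  have hint' : IntegrableOn (f ∘ e) (Icc (-π) π ×ˢ Icc (fun _ : Fin d => -π) (fun _ => π))
      ((volume : Measure ℝ).prod (volume : Measure (Fin d → ℝ))) := by
    have := hf
    rw [BZ, ← hem.integrableOn_comp_preimage e.measurableEmbedding, heπ, Measure.volume_eq_prod] at this
    exact this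
  have he : ∀ t q, e (t, q) = i.insertNth t q := by
    intro t q
    simp [he_def, MeasurableEquiv.piFinSuccAbove_symm_apply, Fin.insertNthEquiv]
  have hprod : Integrable (f ∘ e) ((volume.restrict (Icc (-π) π)).prod (volume.restrict (BZ d))) := by
    rw [Measure.prod_restrict, BZ]; exact hint'
  have hsw := hprod.swap
  refine hsw.congr (Eventually.of_forall fun z => ?_)
  simp only [Function.comp_apply, he, Prod.fst_swap, Prod.snd_swap]

/-- [folklore] **FUBINI ON THE BOX, SINGLING OUT THE COORDINATE `i`**, for an arbitrary integrable `f`: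
`∫_{BZ (d+1)} f = ∫_{q ∈ BZ d} ∫_{t ∈ [−π,π]} f (insertNth i t q)`. -/
theorem setIntegral_BZ_eq_iterated [NormedSpace ℝ E] (f : (Fin (d + 1) → ℝ) → E) (i : Fin (d + 1)) (hf : IntegrableOn f (BZ (d + 1)) volume) :
    ∫ s in BZ (d + 1), f s = ∫ q in BZ d, ∫ t in Icc (-π) π, f (i.insertNth t q) := by
  set e : ℝ × (Fin d → ℝ) ≃ᵐ (Fin (d + 1) → ℝ) := (MeasurableEquiv.piFinSuccAbove (fun _ => ℝ) i).symm with he_def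
  have hem : MeasurePreserving e :=
    (volume_preserving_piFinSuccAbove (fun _ : Fin (d + 1) => ℝ) i).symm _
  have heπ : (e ⁻¹' Icc (fun _ => -π) fun _ => π) = Icc (-π) π ×ˢ Icc (fun _ : Fin d => -π) (fun _ => π) :=
    ((Fin.insertNthOrderIso (fun _ => ℝ) i).preimage_Icc _ _).trans (Icc_prod_eq _ _)
  have hint' : IntegrableOn (f ∘ e) (Icc (-π) π ×ˢ Icc (fun _ : Fin d => -π) (fun _ => π))
      ((volume : Measure ℝ).prod (volume : Measure (Fin d → ℝ))) := by
    have := hf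
    rw [BZ, ← hem.integrableOn_comp_preimage e.measurableEmbedding, heπ, Measure.volume_eq_prod] at this
    exact this
  have he : ∀ t q, e (t, q) = i.insertNth t q := by
    intro t q
    simp [he_def, MeasurableEquiv.piFinSuccAbove_symm_apply, Fin.insertNthEquiv]
  rw [BZ, ← hem.map_eq, setIntegral_map_equiv, heπ, Measure.volume_eq_prod, ← setIntegral_prod_swap,
    setIntegral_prod (fun z => f (e z.swap)) (by exact hint'.swap)]
  refine setIntegral_congr_fun measurableSet_Icc fun q _ => ?_
  refine setIntegral_congr_fun measurableSet_Icc fun t _ => ?_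
  simp only [Prod.swap_prod_mk, he]

/-- [folklore] the inner (one-coordinate) integral of an integrable `f` is integrable in the transverse momentum. -/
theorem integrableOn_sliceIntegral [NormedSpace ℝ E] (f : (Fin (d + 1) → ℝ) → E) (i : Fin (d + 1)) (hf : IntegrableOn f (BZ (d + 1)) volume) :
    IntegrableOn (fun q : Fin d → ℝ => ∫ t in Icc (-π) π, f (i.insertNth t q)) (BZ d) volume :=
  (integrable_swap_slices f i hf).integral_prod_left

/-- [folklore] almost every slice of an integrable `f` is integrable on `[−π,π]`. -/
theorem ae_integrableOn_slice (f : (Fin (d + 1) → ℝ) → E) (i : Fin (d + 1)) (hf : IntegrableOn f (BZ (d + 1)) volume) :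
    ∀ᵐ q ∂(volume.restrict (BZ d)), IntegrableOn (fun t : ℝ => f (i.insertNth t q)) (Icc (-π) π) volume :=
  (integrable_swap_slices f i hf).prod_right_ae

end Fubini

/-! ## §2 `r` integrations by parts in one coordinate, the top member only majorised -/

/-- [folklore] **`r`-FOLD INTEGRATION BY PARTS IN THE COORDINATE `i` WITH A MAJORISED TOP MEMBER**: `F 0, …, F r` a punctured slice chain off the
null set `N` of transverse momenta (links `HasDerivAt` on `(−π, π)`, continuity on `[−π, π]` and equal endpoint values for `j < r`), the slices of the top member
`F r` a.e.-strongly measurable on `[−π,π]` and majorised there by `g (insertNth i t q)` with `g` integrable on the box, `F 0` with an integrable box integrand: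
`|x_i|^r · ‖fourierBox (F 0) x‖ ≤ ∫_{BZ (d+1)} g`. -/
theorem norm_fourierBox_le_of_coordDeriv_majorant (i : Fin (d + 1)) (r : ℕ) (F : ℕ → (Fin (d + 1) → ℂ) → ℂ) (x : Fin (d + 1) → ℤ)
    (N : Set (Fin d → ℝ)) (hN : volume N = 0)
    (hint : IntegrableOn (integrand (F 0) x) (BZ (d + 1)))
    (hder : ∀ j < r, ∀ q ∈ BZ d, q ∉ N → ∀ t ∈ Set.Ioo (-π) π,
      HasDerivAt (fun s : ℝ => F j (i.insertNth (s : ℂ) (ofRealVec q))) (F (j + 1) (i.insertNth (t : ℂ) (ofRealVec q))) t)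
    (hcont : ∀ j < r, ∀ q ∈ BZ d, q ∉ N → ContinuousOn (fun s : ℝ => F j (i.insertNth (s : ℂ) (ofRealVec q))) (Set.uIcc (-π) π))
    (hper : ∀ j < r, ∀ q ∈ BZ d, q ∉ N →
      F j (i.insertNth (((-π : ℝ)) : ℂ) (ofRealVec q)) = F j (i.insertNth ((π : ℝ) : ℂ) (ofRealVec q)))
    (hmeas : ∀ q ∈ BZ d, q ∉ N →
      AEStronglyMeasurable (fun s : ℝ => F r (i.insertNth (s : ℂ) (ofRealVec q))) (volume.restrict (Icc (-π) π)))
    {g : (Fin (d + 1) → ℝ) → ℝ} (hg : IntegrableOn g (BZ (d + 1)) volume)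
    (hmaj : ∀ q ∈ BZ d, q ∉ N → ∀ t ∈ Set.Icc (-π) π, ‖F r (i.insertNth (t : ℂ) (ofRealVec q))‖ ≤ g (i.insertNth t q)) :
    |(x i : ℝ)| ^ r * ‖fourierBox (F 0) x‖ ≤ ∫ s in BZ (d + 1), g s := by
  have hBZ : MeasurableSet (BZ d) := by unfold BZ; exact measurableSet_Icc
  have hππ : -π ≤ π := by linarith [Real.pi_pos]
  -- Fubini facts for the majorant
  have hGint := integrableOn_sliceIntegral g i hg
  have hGae := ae_integrableOn_slice g i hg
  have hGeq := setIntegral_BZ_eq_iterated g i hg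
  -- a.e. transverse momentum avoids `N`
  have hae : ∀ᵐ q ∂(volume.restrict (BZ d)), q ∉ N := ae_restrict_of_ae (measure_eq_zero_iff_ae_notMem.mp hN)
  have hmem : ∀ᵐ q ∂(volume.restrict (BZ d)), q ∈ BZ d := ae_restrict_mem hBZ
  -- the key slice-wise bound
  have key : ∀ᵐ q ∂(volume.restrict (BZ d)),
      ‖(-(I * x i)) ^ r * ∫ t in Icc (-π) π, integrand (F 0) x (i.insertNth t q)‖ ≤ ∫ t in Icc (-π) π, g (i.insertNth t q) := by
    filter_upwards [hae, hmem, hGae] with q hqN hq hgq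
    set C : ℂ := cexp (I * phase q (fun j => x (i.succAbove j))) with hC
    have hCn : ‖C‖ = 1 := norm_cexp_phase q _
    have hI : ∀ j, (∫ t in Icc (-π) π, integrand (F j) x (i.insertNth t q))
        = ∫ t in (-π)..π, (F j (i.insertNth (t : ℂ) (ofRealVec q)) * C) * cexp (I * (t : ℂ) * (x i)) := by
      intro j
      rw [intervalIntegral.integral_of_le hππ, integral_Icc_eq_integral_Ioc]
      refine setIntegral_congr_fun measurableSet_Ioc fun t _ => ?_
      simp only [integrand, ofRealVec_insertNth, phase_insertNth, mul_add, Complex.exp_add, hC]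
      ring
    -- interval integrability of the top slice from measurability + majorant
    have htopI : IntegrableOn (fun s : ℝ => F r (i.insertNth (s : ℂ) (ofRealVec q))) (Icc (-π) π) volume := by
      refine Integrable.mono' hgq (hmeas q hq hqN) ?_
      filter_upwards [ae_restrict_mem measurableSet_Icc] with t ht
      exact hmaj q hq hqN t ht
    have htop : IntervalIntegrable (fun s : ℝ => F r (i.insertNth (s : ℂ) (ofRealVec q)) * C) volume (-π) π := by
      refine (IntegrableOn.intervalIntegrable ?_).mul_const C
      rw [uIcc_of_le hππ]; exact htopI
    have hparts := integral_iteratedDeriv_mul_char_Ioo' (n := x i) r (fun j t => F j (i.insertNth (t : ℂ) (ofRealVec q)) * C)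
      (fun j hj t ht => (hder j hj q hq hqN t ht).mul_const C)
      (fun j hj => (hcont j hj q hq hqN).mul continuousOn_const) htop
      (fun j hj => by simp only [hper j hj q hq hqN])
    rw [hI 0, ← hparts, intervalIntegral.integral_of_le hππ, ← integral_Icc_eq_integral_Ioc]
    refine norm_integral_le_of_norm_le hgq ?_
    filter_upwards [ae_restrict_mem measurableSet_Icc] with t ht
    rw [norm_mul, norm_mul, hCn, mul_one]
    have hch : ‖cexp (I * (t : ℂ) * (x i : ℤ))‖ = 1 := by
      rw [show I * (t : ℂ) * (x i : ℤ) = ((t * (x i : ℤ) : ℝ) : ℂ) * I by push_cast; ring, Complex.norm_exp_ofReal_mul_I]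
    rw [hch, mul_one]
    exact hmaj q hq hqN t ht
  -- assemble
  have hn : |(x i : ℝ)| ^ r * ‖fourierBox (F 0) x‖ = ‖(-(I * x i)) ^ r * fourierBox (F 0) x‖ := by
    rw [norm_mul, norm_pow, norm_neg, norm_mul, Complex.norm_I, one_mul, Complex.norm_intCast]
  rw [hn, fourierBox_eq_iterated (F 0) x i hint, ← integral_const_mul, hGeq]
  exact norm_integral_le_of_norm_le hGint key

/-- [folklore] … for the normalised lattice kernel: `|x_i|^r · ‖latticeKernel (F 0) x‖ ≤ (2π)^{-(d+1)} · ∫_{BZ (d+1)} g`. -/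
theorem norm_latticeKernel_le_of_coordDeriv_majorant (i : Fin (d + 1)) (r : ℕ) (F : ℕ → (Fin (d + 1) → ℂ) → ℂ) (x : Fin (d + 1) → ℤ)
    (N : Set (Fin d → ℝ)) (hN : volume N = 0)
    (hint : IntegrableOn (integrand (F 0) x) (BZ (d + 1)))
    (hder : ∀ j < r, ∀ q ∈ BZ d, q ∉ N → ∀ t ∈ Set.Ioo (-π) π,
      HasDerivAt (fun s : ℝ => F j (i.insertNth (s : ℂ) (ofRealVec q))) (F (j + 1) (i.insertNth (t : ℂ) (ofRealVec q))) t)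
    (hcont : ∀ j < r, ∀ q ∈ BZ d, q ∉ N → ContinuousOn (fun s : ℝ => F j (i.insertNth (s : ℂ) (ofRealVec q))) (Set.uIcc (-π) π))
    (hper : ∀ j < r, ∀ q ∈ BZ d, q ∉ N →
      F j (i.insertNth (((-π : ℝ)) : ℂ) (ofRealVec q)) = F j (i.insertNth ((π : ℝ) : ℂ) (ofRealVec q)))
    (hmeas : ∀ q ∈ BZ d, q ∉ N →
      AEStronglyMeasurable (fun s : ℝ => F r (i.insertNth (s : ℂ) (ofRealVec q))) (volume.restrict (Icc (-π) π)))
    {g : (Fin (d + 1) → ℝ) → ℝ} (hg : IntegrableOn g (BZ (d + 1)) volume)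
    (hmaj : ∀ q ∈ BZ d, q ∉ N → ∀ t ∈ Set.Icc (-π) π, ‖F r (i.insertNth (t : ℂ) (ofRealVec q))‖ ≤ g (i.insertNth t q)) :
    |(x i : ℝ)| ^ r * ‖latticeKernel (F 0) x‖ ≤ ((2 * π) ^ (d + 1))⁻¹ * ∫ s in BZ (d + 1), g s := by
  have h := norm_fourierBox_le_of_coordDeriv_majorant i r F x N hN hint hder hcont hper hmeas hg hmaj
  have hpos : (0 : ℝ) < (2 * π) ^ (d + 1) := by positivity
  unfold latticeKernel
  rw [norm_smul, Real.norm_eq_abs, abs_of_pos (inv_pos.mpr hpos), mul_left_comm]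
  exact mul_le_mul_of_nonneg_left h (inv_pos.mpr hpos).le

/-! ## §3 Sup-norm decay from a majorised punctured chain in EVERY coordinate -/

/-- [folklore] **SUP-NORM POWER-LAW DECAY, MAJORISED TOP MEMBERS**: with a punctured slice chain of length `r` in EVERY coordinate (`F μ 0 = G`), top
members with a.e.-measurable slices majorised by ONE integrable `g` on the box, `‖latticeKernel G x‖ ≤ (2π)^{-(d+1)}·(∫_{BZ} g) / ‖x‖_∞^r` for every `x ≠ 0`
(`‖x‖_∞ = B4ContourShift.supNorm x`). -/
theorem norm_latticeKernel_le_div_supNorm_pow_of_majorant {G : (Fin (d + 1) → ℂ) → ℂ} (r : ℕ) (F : Fin (d + 1) → ℕ → (Fin (d + 1) → ℂ) → ℂ)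
    (hF0 : ∀ μ, F μ 0 = G) (N : Set (Fin d → ℝ)) (hN : volume N = 0)
    (hint : ∀ x, IntegrableOn (integrand G x) (BZ (d + 1)))
    (hder : ∀ μ, ∀ j < r, ∀ q ∈ BZ d, q ∉ N → ∀ t ∈ Set.Ioo (-π) π,
      HasDerivAt (fun s : ℝ => F μ j (μ.insertNth (s : ℂ) (ofRealVec q))) (F μ (j + 1) (μ.insertNth (t : ℂ) (ofRealVec q))) t)
    (hcont : ∀ μ, ∀ j < r, ∀ q ∈ BZ d, q ∉ N → ContinuousOn (fun s : ℝ => F μ j (μ.insertNth (s : ℂ) (ofRealVec q))) (Set.uIcc (-π) π))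
    (hper : ∀ μ, ∀ j < r, ∀ q ∈ BZ d, q ∉ N →
      F μ j (μ.insertNth (((-π : ℝ)) : ℂ) (ofRealVec q)) = F μ j (μ.insertNth ((π : ℝ) : ℂ) (ofRealVec q)))
    (hmeas : ∀ μ, ∀ q ∈ BZ d, q ∉ N →
      AEStronglyMeasurable (fun s : ℝ => F μ r (μ.insertNth (s : ℂ) (ofRealVec q))) (volume.restrict (Icc (-π) π)))
    {g : (Fin (d + 1) → ℝ) → ℝ} (hg : IntegrableOn g (BZ (d + 1)) volume)
    (hmaj : ∀ μ, ∀ q ∈ BZ d, q ∉ N → ∀ t ∈ Set.Icc (-π) π, ‖F μ r (μ.insertNth (t : ℂ) (ofRealVec q))‖ ≤ g (μ.insertNth t q))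
    (x : Fin (d + 1) → ℤ) (hx : x ≠ 0) :
    ‖latticeKernel G x‖ ≤ ((2 * π) ^ (d + 1))⁻¹ * (∫ s in BZ (d + 1), g s) / B4ContourShift.supNorm x ^ r := by
  -- the coordinate realising the sup norm
  obtain ⟨μ, -, hμ⟩ := Finset.exists_mem_eq_sup' (Finset.univ_nonempty (α := Fin (d + 1))) (fun i => ((|x i| : ℤ) : ℝ))
  have hsup : B4ContourShift.supNorm x = |(x μ : ℝ)| := by
    unfold B4ContourShift.supNorm; rw [hμ, Int.cast_abs]
  have hxμ : x μ ≠ 0 := by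
    intro h0
    apply hx
    funext i
    have hle : ((|x i| : ℤ) : ℝ) ≤ ((|x μ| : ℤ) : ℝ) := by
      rw [← hμ]; exact Finset.le_sup' (fun i => ((|x i| : ℤ) : ℝ)) (Finset.mem_univ i)
    rw [h0, abs_zero, Int.cast_zero] at hle
    have : |x i| ≤ 0 := by exact_mod_cast hle
    exact abs_nonpos_iff.mp this
  have h := norm_latticeKernel_le_of_coordDeriv_majorant μ r (F μ) x N hN (by rw [hF0 μ]; exact hint x) (hder μ) (hcont μ) (hper μ)
    (hmeas μ) hg (hmaj μ)
  rw [hF0 μ] at h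
  rw [hsup]
  have hpos : 0 < |(x μ : ℝ)| ^ r := pow_pos (abs_pos.mpr (by exact_mod_cast hxμ)) r
  rw [le_div_iff₀ hpos, mul_comm]
  exact h

end Summit.QuantumFields.BalabanUV.Beta.FP.PuncturedCoordDerivMajorant

end
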